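import Summits.BirchSwinnertonDyer.BirchSwinnertonDyer.Theorems.SylvesterTwoHeegnerIndexCoupledTelescopeOnePhi
import Summits.BirchSwinnertonDyer.BirchSwinnertonDyer.Theorems.SylvesterTwoHeegnerIndexCoupledTelescopeLagrangianPackage
import Literature.NumberTheory.EllipticCurves.CasselsTateCanonicalPackageOfResCor
import Literature.NumberTheory.EllipticCurves.WeilPairingBaseChangeCompat
import Literature.NumberTheory.EllipticCurves.ShaRestrictionJZeroDescent
import Literature.NumberTheory.EllipticCurves.CasselsTateFiniteSupport
import Literature.NumberTheory.GaloisCohomology.PoitouTateNumberField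
import Literature.NumberTheory.EllipticCurves.CasselsTateAlternating
import HarnessLib

/-!
# The COUPLED Cassels–Tate telescope, XVI: the PER-CURVE OBJECTS PACKAGE on the CONSTRUCTED pairing —
# `(φ, w_S, w, r)`, the Weil datum, `B₂ = ctLevelPairing … canonical`, `ι₂`, the Selmer pull-back
# `P`, and the descended Lagrangian with (iso)/(coiso) (instantiation lane, planner D620/D625/D629)

Crux `UpperOffV0HSYPlus` (stmt-BirchSwinnertonDyer-19804); display hT^κ = `…TailFourKappa` (p704180)
l.89–236.  For ONE curve `E = W/ℚ` (`j = 0` short model) over `K ∋ ω` at the level `m = 2^κ`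
(`κ ≥ 1`, `2^κ` killing `Ш(E/ℚ)[2^∞]` and `Ш(E_K/K)[2^∞]`), this file runs SPEC-K-TY § (CT-4′)'s ONE
CALL on the one-φ package (file XIII, p708199) and returns hT^κ's per-curve OBJECTS as terms with their
consumed clauses:

* from XIII `exists_onePhi_package`: `φ = [ζ]` pinned, `fn = φ|E[n]`, `r`, `w`, the Selmer-level
  operator `w_S = resH1Hom id fn hfn` with (i)/(iii), the descent bijection;
* the Weil datum `eK` on `E_K[4^κ]` with its six properties (`exists_weilPairing_baseChange_compat`,
  p701905);
* `B₂ := ctLevelPairing (E⁄K) (2^κ) eK … (LocalInvariants.canonical K (4^κ)) …` on `Ш(E_K)[2^∞]`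
  (p700609 ★★ `exists_primaryComponent_ctLevelPairing`, identified with the package's pairing by the
  shared pinning clause) — via k-ty1 #33 `exists_ctLevelPairing_resCor_package_of_resCor` (p707257) with
  `hφ3` from the SAME `φ`'s point relation (k-ty1 g12 `GlueCheckV`, planner D629 (a));
* `ι₂ : Sel_{4^κ}(E_K) → Ш(E_K)[2^∞]` over `torsionH1ToH1` (`exists_selmerToPrimaryComponent`);
* `P z t := (B₂ (ι₂ z) (ι₂ t), B₂ (ι₂ z) (w (ι₂ t)))` as a bi-additive map (hT^κ's `P_X`);
* the `ℚ`-Lagrangian `L` with `(#L)² = #Ш(E/ℚ)[2^∞]` and `D = closure (r(L) ∪ w '' r(L))` ISOTROPIC and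
  COISOTROPIC for `B₂` (#K8′ p701264 on `h2B`/`hwB`/`hbal'` of the package).

DISPLAYED (cone-interim / printed input, FULLY QUANTIFIED, planner D590/D621): `VII` = clause (vii)
[Fisher 2003 Prop. 2.16] in #33's binder shape for every quadratic `K`, `W`, `m = 2^k`, Weil data;
`H3` = `Ш³(F, μ_n) = 0` for every number field; `LP` = the LEVEL property of Milne's recipe on the
canonical family.  Theorem-only (no definition, no named fact); nothing asserted on 19804; no stub
closed; X12.CMAtTwo NOT proved; BSD not claimed for any curve.  Sources: Milne ADT I §6 Prop. 6.9 /
Rem. 6.10(a) / Thm. 6.13(a); Fisher 2003 Prop. 2.16; McCallum 1991 §5 p. 288; MEMO-bsd-cm-two §59, §64.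
-/

-- every Summits module is named `Summit.<Summit>.<Problem>…`: the duplicated component is by design
set_option linter.dupNamespace false
set_option autoImplicit false

noncomputable section

open scoped Classical AddSubgroup

open WeierstrassCurve Literature.NumberTheory.EllipticCurves Field NumberField
  Literature.NumberTheory.GaloisRepresentations Literature.NumberTheory.GaloisCohomology
  Literature.GroupTheory.FiniteAbelian
open Literature.NumberTheory.GaloisRepresentations.DiscreteGaloisModule (mu)

namespace Summit.BirchSwinnertonDyer.BirchSwinnertonDyer.Theorems.SylvesterTwoCoupledTelescope

section CurvePackage

variable (E : WeierstrassCurve ℚ) [E.IsElliptic] (K : Type) [Field K] [NumberField K]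

set_option maxHeartbeats 800000 in
/-- **The per-curve OBJECTS PACKAGE on the constructed pairing** (module docstring): at `m = 2^κ`,
`κ ≥ 1`, with `2^κ` killing `Ш(E/ℚ)[2^∞]` (finite) and `Ш(E_K/K)[2^∞]`, and the displayed `VII`/`H3`/`LP`:
the one-φ data, the Weil datum `eK` (six properties), `hle : Ш(E_K)[2^∞] ≤ Ш(E_K)[2^κ]`, the
CONSTRUCTED `B₂ = ctLevelPairing (E⁄K) (2^κ) eK … canonical …` on `Ш(E_K)[2^∞]`, `ι₂`, the Selmer
pull-back `P`, and the `ℚ`-Lagrangian `L` with `D = closure (r(L) ∪ w '' r(L))` isotropic and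
coisotropic for `B₂`. [cite: MilneADT2006, Ch. I §6 Prop. 6.9, Rem. 6.10(a), Thm. 6.13(a)]
[cite: Fisher2003, Prop. 2.16 (JNT 98, p. 132)] [cite: McCallumLMS1991, §5 (p. 288)] -/
theorem exists_curve_package (ha₁ : E.a₁ = 0) (ha₂ : E.a₂ = 0) (ha₃ : E.a₃ = 0) (ha₄ : E.a₄ = 0)
    {ω : K} (hω : ω ^ 2 + ω + 1 = 0) (h2 : Module.finrank ℚ K = 2) (κ : ℕ) (hκ : 1 ≤ κ)
    (hkℚ : ∀ x ∈ AddCommGroup.primaryComponent E.sha 2, 2 ^ κ • x = 0)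
    (hkK : ∀ x ∈ AddCommGroup.primaryComponent (E.baseChange K).sha 2, 2 ^ κ • x = 0)
    [Finite (AddCommGroup.primaryComponent E.sha 2)]
    -- VII = clause (vii) of `casselsTate_canonical_adjoint` VERBATIM, for every quadratic `K` [Fisher 2003
    -- Prop. 2.16 for Milne's recipe on compatible canonical families] — the ONE printed pairing input (D636)
    (hvii : ∀ (K : Type) [Field K] [NumberField K] (σ₀ : K ≃ₐ[ℚ] K) (h2 : Module.finrank ℚ K = 2)
      (hσ₀ : σ₀ ≠ 1),
      ∀ (W : WeierstrassCurve ℚ) [W.IsElliptic] (m : ℕ) [NeZero m]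
      (eℚ : geomTorsion W ((m * m : ℕ) : ℤ) → geomTorsion W ((m * m : ℕ) : ℤ) → AlgebraicClosure ℚ)
      (hμ : ∀ S T, eℚ S T ^ (m * m) = 1)
      (hadd₁ : ∀ S₁ S₂ T, eℚ (S₁ + S₂) T = eℚ S₁ T * eℚ S₂ T)
      (hadd₂ : ∀ S T₁ T₂, eℚ S (T₁ + T₂) = eℚ S T₁ * eℚ S T₂)
      (hgal : ∀ (σ : absoluteGaloisGroup ℚ) (S T : geomTorsion W ((m * m : ℕ) : ℤ)),
        σ • eℚ S T = eℚ (σ • S) (σ • T))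
      (eK : geomTorsion (W.baseChange K) ((m * m : ℕ) : ℤ) →
        geomTorsion (W.baseChange K) ((m * m : ℕ) : ℤ) → AlgebraicClosure K)
      (hμK : ∀ S T, eK S T ^ (m * m) = 1)
      (hadd₁K : ∀ S₁ S₂ T, eK (S₁ + S₂) T = eK S₁ T * eK S₂ T)
      (hadd₂K : ∀ S T₁ T₂, eK S (T₁ + T₂) = eK S T₁ * eK S T₂)
      (hgalK : ∀ (σ : absoluteGaloisGroup K) (S T : geomTorsion (W.baseChange K) ((m * m : ℕ) : ℤ)),
        σ • eK S T = eK (σ • S) (σ • T)),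
      (∀ T, eℚ T T = 1) → (∀ T, (∀ S, eℚ S T = 1) → T = 0) →
      (∀ T, eK T T = 1) → (∀ T, (∀ S, eK S T = 1) → T = 0) →
      (∀ (S T : geomTorsion W ((m * m : ℕ) : ℤ)) (S' T' : geomTorsion (W.baseChange K) ((m * m : ℕ) : ℤ)),
        (S' : geomPoints (W.baseChange K)) = geomPointsEquivBaseChange K W S →
        (T' : geomPoints (W.baseChange K)) = geomPointsEquivBaseChange K W T →
        (eK S' T' : AlgebraicClosure K) = closureEmb (K := ℚ) K (eℚ S T)) →
      ∀ (a : W.galH1) (c : (W.baseChange K).galH1), a ∈ W.sha → c ∈ (W.baseChange K).sha →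
        (m : ℤ) • a = 0 → (m : ℤ) • c = 0 → corBaseChange K W σ₀ h2 hσ₀ c ∈ W.sha →
        ctGeneralFun (W.baseChange K) m eK hμK hadd₁K hadd₂K hgalK (LocalInvariants.canonical K (m * m))
            (resBaseChange W K a) c =
          ctGeneralFun W m eℚ hμ hadd₁ hadd₂ hgal (LocalInvariants.canonical ℚ (m * m))
            a (corBaseChange K W σ₀ h2 hσ₀ c))
    -- `Ш³(F, μ_n) = 0` (cone-interim, displayed)
    (hH3 : ∀ (F : Type) [Field F] [NumberField F] (n : ℕ) [NeZero n] (c : galoisCohomology (mu F n) 3),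
      (∀ v : Place F, galoisCohomology.localization (mu F n) v 3 c = 0) → c = 0)
    -- LP = the cone's `isLevelPairing_ctLevelPairing_canonical_of_alt`, its type fully quantified (the
    -- `Ш³ = 0` proof a bound variable) (cone-interim, displayed; D635 (R6))
    (hLP : ∀ (K : Type) [Field K] [NumberField K] (W : WeierstrassCurve K) [W.IsElliptic] (p k : ℕ)
      [Fact p.Prime]
      (e : geomTorsion W ((p ^ k * p ^ k : ℕ) : ℤ) → geomTorsion W ((p ^ k * p ^ k : ℕ) : ℤ) →
        AlgebraicClosure K)
      (hμ : ∀ S T, e S T ^ (p ^ k * p ^ k) = 1)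
      (hadd₁ : ∀ S₁ S₂ T, e (S₁ + S₂) T = e S₁ T * e S₂ T)
      (hadd₂ : ∀ S T₁ T₂, e S (T₁ + T₂) = e S T₁ * e S T₂)
      (hgal : ∀ (σ : absoluteGaloisGroup K) (S T : geomTorsion W ((p ^ k * p ^ k : ℕ) : ℤ)),
        σ • e S T = e (σ • S) (σ • T))
      (halt : ∀ T, e T T = 1) (hnd : ∀ T, (∀ S, e S T = 1) → T = 0)
      [NeZero (p ^ k)] [NeZero (p ^ k * p ^ k)], 0 < k →
      (∀ a ∈ W.sha, ((p ^ k : ℕ) : ℤ) • a = 0 →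
        ctGeneralFun W (p ^ k) e hμ hadd₁ hadd₂ hgal (LocalInvariants.canonical K (p ^ k * p ^ k)) a a = 0) →
      ∀ (hH3' : ∀ c : galoisCohomology (mu K (p ^ k * p ^ k)) 3,
        (∀ v : Place K, galoisCohomology.localization (mu K (p ^ k * p ^ k)) v 3 c = 0) → c = 0),
      IsLevelPairing (p ^ k)
        (ctLevelPairing W (p ^ k) e hμ hadd₁ hadd₂ hgal (LocalInvariants.canonical K (p ^ k * p ^ k)) halt
          (sumInvLocalizationEqZero_canonical_of_numberField K (p ^ k * p ^ k)) hH3'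
          (localTerm_finite_support W (p ^ k) e hμ hadd₁ hadd₂ hgal halt
            (LocalInvariants.canonical K (p ^ k * p ^ k))))) :
    ∃ (φ : Isogeny (E.baseChange K) (E.baseChange K))
      (fn : geomTorsion (E.baseChange K) ((2 ^ κ * 2 ^ κ : ℕ) : ℤ) →+
        geomTorsion (E.baseChange K) ((2 ^ κ * 2 ^ κ : ℕ) : ℤ))
      (hfn : ∀ (g : absoluteGaloisGroup K) (Q : geomTorsion (E.baseChange K) ((2 ^ κ * 2 ^ κ : ℕ) : ℤ)),
        fn (ContinuousMonoidHom.id _ g • Q) = g • fn Q)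
      (r : AddCommGroup.primaryComponent E.sha 2 →+ AddCommGroup.primaryComponent (E.baseChange K).sha 2)
      (w : AddCommGroup.primaryComponent (E.baseChange K).sha 2 →+
        AddCommGroup.primaryComponent (E.baseChange K).sha 2)
      (eK : geomTorsion (E.baseChange K) ((2 ^ κ * 2 ^ κ : ℕ) : ℤ) →
        geomTorsion (E.baseChange K) ((2 ^ κ * 2 ^ κ : ℕ) : ℤ) → AlgebraicClosure K)
      (hμK : ∀ S T, eK S T ^ (2 ^ κ * 2 ^ κ) = 1)
      (hadd₁K : ∀ S₁ S₂ T, eK (S₁ + S₂) T = eK S₁ T * eK S₂ T)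
      (hadd₂K : ∀ S T₁ T₂, eK S (T₁ + T₂) = eK S T₁ * eK S T₂)
      (hgalK : ∀ (σ : absoluteGaloisGroup K) (S T : geomTorsion (E.baseChange K) ((2 ^ κ * 2 ^ κ : ℕ) : ℤ)),
        σ • eK S T = eK (σ • S) (σ • T))
      (haltK : ∀ T, eK T T = 1)
      (hle : AddCommGroup.primaryComponent (E.baseChange K).sha 2 ≤ ((E.baseChange K).sha)[2 ^ κ])
      (B₂ : AddCommGroup.primaryComponent (E.baseChange K).sha 2 →+
        AddCommGroup.primaryComponent (E.baseChange K).sha 2 →+ AddCircle (1 : ℚ))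
      (ι₂ : selmerGroup (E.baseChange K) ((2 ^ κ * 2 ^ κ : ℕ) : ℤ) →+
        AddCommGroup.primaryComponent (E.baseChange K).sha 2)
      (P : selmerGroup (E.baseChange K) ((2 ^ κ * 2 ^ κ : ℕ) : ℤ) →+
        selmerGroup (E.baseChange K) ((2 ^ κ * 2 ^ κ : ℕ) : ℤ) →+ AddCircle (1 : ℚ) × AddCircle (1 : ℚ))
      (L : AddSubgroup (AddCommGroup.primaryComponent E.sha 2)),
      -- the one-φ clauses consumed downstream
      (∀ (x y : AlgebraicClosure K)
        (h : ((E.baseChange K).baseChange (AlgebraicClosure K)).toAffine.Nonsingular x y),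
        ∃ h', φ (Affine.Point.some x y h) =
          Affine.Point.some (algebraMap K (AlgebraicClosure K) ω ^ 2 * x)
            (algebraMap K (AlgebraicClosure K) ω ^ 3 * y) h') ∧
      (∀ Q : geomTorsion (E.baseChange K) ((2 ^ κ * 2 ^ κ : ℕ) : ℤ),
        ((fn Q : geomTorsion (E.baseChange K) ((2 ^ κ * 2 ^ κ : ℕ) : ℤ)) : geomPoints (E.baseChange K)) =
          φ Q) ∧
      (∀ c, ((r c : AddCommGroup.primaryComponent (E.baseChange K).sha 2) : (E.baseChange K).sha) =
        shaRestriction E K c) ∧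
      (∀ x, (((w x : AddCommGroup.primaryComponent (E.baseChange K).sha 2) : (E.baseChange K).sha) :
          (E.baseChange K).galH1) =
        galH1Map φ.toAddMonoidHom φ.equivariant ((x : (E.baseChange K).sha) : (E.baseChange K).galH1)) ∧
      (∀ c, torsionH1ToH1 (E.baseChange K) ((2 ^ κ * 2 ^ κ : ℕ) : ℤ)
          (resH1Hom (ContinuousMonoidHom.id _) fn hfn c) =
        galH1Map φ.toAddMonoidHom φ.equivariant
          (torsionH1ToH1 (E.baseChange K) ((2 ^ κ * 2 ^ κ : ℕ) : ℤ) c)) ∧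
      (∀ c ∈ selmerGroup (E.baseChange K) ((2 ^ κ * 2 ^ κ : ℕ) : ℤ),
        resH1Hom (ContinuousMonoidHom.id _) fn hfn c ∈ selmerGroup (E.baseChange K) ((2 ^ κ * 2 ^ κ : ℕ) : ℤ)) ∧
      (Function.Bijective fun cd : AddCommGroup.primaryComponent E.sha 2 ×
          AddCommGroup.primaryComponent E.sha 2 ↦ r cd.1 + w (r cd.2)) ∧
      (∀ x, w (w x) = -x - w x) ∧
      -- the Weil datum is non-degenerate
      (∀ T, (∀ S, eK S T = 1) → T = 0) ∧
      -- `B₂` IS the constructed pairing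
      (∀ a b, B₂ a b = ctLevelPairing (E.baseChange K) (2 ^ κ) eK hμK hadd₁K hadd₂K hgalK
        (LocalInvariants.canonical K (2 ^ κ * 2 ^ κ)) haltK
        (sumInvLocalizationEqZero_canonical_of_numberField K (2 ^ κ * 2 ^ κ)) (hH3 K (2 ^ κ * 2 ^ κ))
        (localTerm_finite_support (E.baseChange K) (2 ^ κ) eK hμK hadd₁K hadd₂K hgalK haltK
          (LocalInvariants.canonical K (2 ^ κ * 2 ^ κ))) ⟨a, hle a.2⟩ ⟨b, hle b.2⟩) ∧
      -- `ι₂` over `torsionH1ToH1`, and the Selmer pull-back `P`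
      (∀ z, (((ι₂ z : AddCommGroup.primaryComponent (E.baseChange K).sha 2) : (E.baseChange K).sha) :
          (E.baseChange K).galH1) = torsionH1ToH1 (E.baseChange K) ((2 ^ κ * 2 ^ κ : ℕ) : ℤ) z) ∧
      (∀ z t, P z t = (B₂ (ι₂ z) (ι₂ t), B₂ (ι₂ z) (w (ι₂ t)))) ∧
      -- the `ℚ`-Lagrangian and its descended `𝒪`-span: isotropic and coisotropic for `B₂`
      Nat.card L ^ 2 = Nat.card (AddCommGroup.primaryComponent E.sha 2) ∧
      (∀ s ∈ AddSubgroup.closure ((r '' (L : Set _)) ∪ w '' (r '' (L : Set _))),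
        ∀ t ∈ AddSubgroup.closure ((r '' (L : Set _)) ∪ w '' (r '' (L : Set _))), B₂ s t = 0) ∧
      (∀ t, (∀ s ∈ AddSubgroup.closure ((r '' (L : Set _)) ∪ w '' (r '' (L : Set _))), B₂ t s = 0) →
        t ∈ AddSubgroup.closure ((r '' (L : Set _)) ∪ w '' (r '' (L : Set _)))) := by
  -- ### the CM field data and the involution
  obtain ⟨hζ, hK, σ, hσζ, hσ2⟩ := JZero.exists_aut_apply_eq_sq K hω h2
  have hσ1 : σ ≠ 1 := fun h ↦ by
    have e : ω ^ 2 = ω := by rw [← hσζ, h, AlgEquiv.one_apply]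
    have hω0 : ω ≠ 0 := hζ.ne_zero (by norm_num)
    have hω1 : ω = 1 := mul_left_cancel₀ hω0 (by rw [← sq, e, mul_one])
    exact hζ.ne_one (by norm_num) hω1
  haveI : (E.baseChange K).IsElliptic := inferInstanceAs ((E.map (algebraMap ℚ K)).IsElliptic)
  -- ### the one-φ package (XIII) at `n = 2^κ·2^κ`
  obtain ⟨φ, fn, hfn, r, w, s, hφ, hrel, hcoe, hr, hw, hs, hwrel, -, hsw, -, -, -, -, hbij, hwS, -,
    hwSel⟩ := exists_onePhi_package E K hK hσ2 ha₁ ha₂ ha₃ ha₄ h2 hζ hσζ ((2 ^ κ * 2 ^ κ : ℕ) : ℤ)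
  -- ### the Weil data at level `4^κ`
  have h2le : 2 ≤ 2 ^ κ * 2 ^ κ := by
    have h1 : 2 ≤ 2 ^ κ := by
      calc (2 : ℕ) = 2 ^ 1 := (pow_one 2).symm
        _ ≤ 2 ^ κ := Nat.pow_le_pow_right two_pos hκ
    calc (2 : ℕ) ≤ 2 ^ κ := h1
      _ = 2 ^ κ * 1 := (mul_one _).symm
      _ ≤ 2 ^ κ * 2 ^ κ := Nat.mul_le_mul_left _ (Nat.one_le_two_pow)
  obtain ⟨eℚ, eK, ⟨hμ, hadd₁, hadd₂, halt, hnd, hgal⟩, ⟨hμK, hadd₁K, hadd₂K, haltK, hndK, hgalK⟩, hee⟩ :=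
    exists_weilPairing_baseChange_compat K E (2 ^ κ * 2 ^ κ) h2le
  -- Cassels' alternation at level `2^κ` for the canonical families (Literature `ctGeneralFun_self_eq_zero`)
  have haltℚ' : ∀ a ∈ E.sha, ((2 ^ κ : ℕ) : ℤ) • a = 0 →
      ctGeneralFun E (2 ^ κ) eℚ hμ hadd₁ hadd₂ hgal (LocalInvariants.canonical ℚ (2 ^ κ * 2 ^ κ)) a a = 0 :=
    fun a ha hma ↦ ctGeneralFun_self_eq_zero halt (LocalInvariants.canonical ℚ (2 ^ κ * 2 ^ κ))
      (sumInvLocalizationEqZero_canonical_of_numberField ℚ (2 ^ κ * 2 ^ κ)) (hH3 ℚ (2 ^ κ * 2 ^ κ)) ha hma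
  have haltK' : ∀ a ∈ (E.baseChange K).sha, ((2 ^ κ : ℕ) : ℤ) • a = 0 →
      ctGeneralFun (E.baseChange K) (2 ^ κ) eK hμK hadd₁K hadd₂K hgalK
        (LocalInvariants.canonical K (2 ^ κ * 2 ^ κ)) a a = 0 :=
    fun a ha hma ↦ ctGeneralFun_self_eq_zero haltK (LocalInvariants.canonical K (2 ^ κ * 2 ^ κ))
      (sumInvLocalizationEqZero_canonical_of_numberField K (2 ^ κ * 2 ^ κ)) (hH3 K (2 ^ κ * 2 ^ κ)) ha hma
  have hκ0 : 0 < κ := hκ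
  have hLPℚ := hLP ℚ E 2 κ eℚ hμ hadd₁ hadd₂ hgal halt hnd hκ0 haltℚ' (hH3 ℚ (2 ^ κ * 2 ^ κ))
  have hLPK := hLP K (E.baseChange K) 2 κ eK hμK hadd₁K hadd₂K hgalK haltK hndK hκ0 haltK'
    (hH3 K (2 ^ κ * 2 ^ κ))
  -- ### `φ³ = 1` from the point relation (k-ty1 g12 `GlueCheckV`)
  have hφ3 : ∀ Q, φ (φ (φ Q)) = Q := fun Q ↦ by
    rw [← sub_eq_zero]
    have e : φ (φ (φ Q)) - Q = (φ (φ (φ Q)) + φ (φ Q) + φ Q) - (φ (φ Q) + φ Q + Q) := by abel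
    rw [e, hrel (φ Q), hrel Q, sub_zero]
  have hinj : Function.Injective (resBaseChange E K) :=
    JZero.resBaseChange_injective_of_isPrimitiveRoot E K ha₁ ha₂ ha₃ ha₄ h2 hζ hσζ
  -- ### SPEC-K-TY § (CT-4′): the ONE CALL (k-ty1 #33)
  obtain ⟨Bℚ₂, B₂, res₂, -, hBK, hres₂, ⟨haltℚ, -, hndℚ, -⟩, ⟨-, -, -, hbal', -, -⟩, h2B, hwB⟩ :=
    exists_ctLevelPairing_resCor_package_of_resCor E (2 ^ κ) rfl eℚ hμ hadd₁ hadd₂ hgal halt eK hμK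
      hadd₁K hadd₂K hgalK haltK
      (hvii K σ h2 hσ1 E (2 ^ κ) eℚ hμ hadd₁ hadd₂ hgal eK hμK hadd₁K hadd₂K hgalK halt hnd haltK hndK hee)
      (sumInvLocalizationEqZero_canonical_of_numberField ℚ (2 ^ κ * 2 ^ κ)) (hH3 ℚ (2 ^ κ * 2 ^ κ))
      (localTerm_finite_support E (2 ^ κ) eℚ hμ hadd₁ hadd₂ hgal halt
        (LocalInvariants.canonical ℚ (2 ^ κ * 2 ^ κ)))
      (sumInvLocalizationEqZero_canonical_of_numberField K (2 ^ κ * 2 ^ κ)) (hH3 K (2 ^ κ * 2 ^ κ))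
      (localTerm_finite_support (E.baseChange K) (2 ^ κ) eK hμK hadd₁K hadd₂K hgalK haltK
        (LocalInvariants.canonical K (2 ^ κ * 2 ^ κ)))
      hLPℚ hLPK hkℚ hkK φ hφ3 w hw hwrel (isLiftOfAut_liftAut σ) s hs hsw hinj
  -- `res₂ = r` (both lie over `shaRestriction`)
  have hres : res₂ = r := by
    ext c : 1
    exact Subtype.ext ((hres₂ c).trans (hr c).symm)
  rw [hres] at h2B hwB
  -- ### p700609 ★★ on `E⁄K`: the `ctLevelPairing` form, identified with `B₂` by the pinning clause
  obtain ⟨hle, B₂', hB₂'ct, hB₂'pin, -, -, -, -⟩ :=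
    exists_primaryComponent_ctLevelPairing (E.baseChange K) (2 ^ κ) eK hμK hadd₁K hadd₂K hgalK
      (LocalInvariants.canonical K (2 ^ κ * 2 ^ κ)) haltK
      (sumInvLocalizationEqZero_canonical_of_numberField K (2 ^ κ * 2 ^ κ)) (hH3 K (2 ^ κ * 2 ^ κ))
      (localTerm_finite_support (E.baseChange K) (2 ^ κ) eK hμK hadd₁K hadd₂K hgalK haltK
        (LocalInvariants.canonical K (2 ^ κ * 2 ^ κ)))
      Nat.prime_two rfl hLPK hkK
  have hBB : B₂' = B₂ :=
    AddMonoidHom.ext fun a ↦ AddMonoidHom.ext fun b ↦ (hB₂'pin a b).trans (hBK a b).symm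
  subst hBB
  -- ### `ι₂` and the Selmer pull-back `P`
  obtain ⟨ι₂, hι₂, -⟩ := exists_selmerToPrimaryComponent (E.baseChange K) Nat.prime_two hkK
  let F₁ : selmerGroup (E.baseChange K) ((2 ^ κ * 2 ^ κ : ℕ) : ℤ) →+
      selmerGroup (E.baseChange K) ((2 ^ κ * 2 ^ κ : ℕ) : ℤ) →+ AddCircle (1 : ℚ) :=
    (B₂'.compl₂ ι₂).comp ι₂
  let F₂ : selmerGroup (E.baseChange K) ((2 ^ κ * 2 ^ κ : ℕ) : ℤ) →+
      selmerGroup (E.baseChange K) ((2 ^ κ * 2 ^ κ : ℕ) : ℤ) →+ AddCircle (1 : ℚ) :=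
    (B₂'.compl₂ (w.comp ι₂)).comp ι₂
  let P : selmerGroup (E.baseChange K) ((2 ^ κ * 2 ^ κ : ℕ) : ℤ) →+
      selmerGroup (E.baseChange K) ((2 ^ κ * 2 ^ κ : ℕ) : ℤ) →+ AddCircle (1 : ℚ) × AddCircle (1 : ℚ) :=
    { toFun := fun z ↦ (F₁ z).prod (F₂ z)
      map_zero' := by
        rw [map_zero, map_zero]
        exact AddMonoidHom.ext fun _ ↦ rfl
      map_add' := fun z z' ↦ by
        rw [map_add, map_add]
        exact AddMonoidHom.ext fun _ ↦ rfl }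
  have hP : ∀ z t, P z t = (B₂' (ι₂ z) (ι₂ t), B₂' (ι₂ z) (w (ι₂ t))) := fun _ _ ↦ rfl
  -- ### #K8′: the descended Lagrangian
  have hrr : ∀ a c, B₂' (r a) (r c) = (2 : ℤ) • Bℚ₂ a c := fun a c ↦ by
    rw [h2B, two_zsmul, two_nsmul]
  have hsurj : ∀ x, ∃ c d, x = r c + w (r d) := fun x ↦ by
    obtain ⟨⟨c, d⟩, hcd⟩ := hbij.2 x
    exact ⟨c, d, hcd.symm⟩
  have hprim : ∀ c : AddCommGroup.primaryComponent E.sha 2, ∃ k : ℕ, ((2 : ℤ) ^ k) • c = 0 := fun c ↦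
    ⟨κ, Subtype.ext (by
      rw [AddSubgroupClass.coe_zsmul, ZeroMemClass.coe_zero, ← hkℚ c.1 c.2, ← natCast_zsmul]
      norm_cast)⟩
  obtain ⟨L, hLcard, hiso, hcoiso⟩ := exists_coisotropic_lagrangian_of_package Bℚ₂ B₂' r w haltℚ hndℚ
    hwrel hbal' hrr hwB hsurj hprim
  have hw' : ∀ x, w (w x) = -x - w x := fun x ↦ by
    rw [← sub_eq_zero, ← hwrel x]
    abel
  exact ⟨φ, fn, hfn, r, w, eK, hμK, hadd₁K, hadd₂K, hgalK, haltK, hle, B₂', ι₂, P, L, hφ, hcoe, hr, hw, hwS,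
    hwSel, hbij, hw', hndK, hB₂'ct, hι₂, hP, hLcard, hiso, hcoiso⟩

end CurvePackage

end Summit.BirchSwinnertonDyer.BirchSwinnertonDyer.Theorems.SylvesterTwoCoupledTelescope

end
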